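import Mathlib

/-!
# night-2: the doubly degenerate regime — counting the unloaded family (union bound)

Pure `Finset` combinatorics for the type-aware family of the doubly degenerate regime.  For a line trace `S ⊆ W` and
level `k`: the `k`-subsets of `W` inside `S` number `C(|S|, k)` (**`card_filter_subset_powersetCard`**), those with at
most one point off `S` number at most `C(|S|, k) + (|W| − |S|)·C(|S|, k − 1)` (**`card_filter_sdiff_le_one_le`**), and
for three conditions the union bound **`choose_le_card_filter_three`**: `C(|W|, k) ≤ #{Y : Q₁ Y ∧ Q₂ Y ∧ Q₃ Y} +
#{¬ Q₁} + #{¬ Q₂} + #{¬ Q₃}`.  Paper `proofs/NIGHT-2-g35.md` §7.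
-/

namespace PercRepro.Shadow

variable {α : Type*} [DecidableEq α]

/-- The `k`-subsets of `W` inside `S ⊆ W` number `C(|S|, k)`. -/
theorem card_filter_subset_powersetCard (W S : Finset α) (hS : S ⊆ W) (k : ℕ) :
    ((W.powersetCard k).filter (fun Y => Y ⊆ S)).card = S.card.choose k := by
  have h : (W.powersetCard k).filter (fun Y => Y ⊆ S) = S.powersetCard k := by
    ext Y
    rw [Finset.mem_filter, Finset.mem_powersetCard, Finset.mem_powersetCard]
    constructor
    · rintro ⟨⟨-, hk⟩, hYS⟩; exact ⟨hYS, hk⟩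
    · rintro ⟨hYS, hk⟩; exact ⟨⟨hYS.trans hS, hk⟩, hYS⟩
  rw [h, Finset.card_powersetCard]

/-- The `k`-subsets of `W` with at most one point off `S ⊆ W` number at most
`C(|S|, k) + (|W| − |S|)·C(|S|, k − 1)`. -/
theorem card_filter_sdiff_le_one_le (W S : Finset α) (hS : S ⊆ W) (k : ℕ) :
    ((W.powersetCard k).filter (fun Y => (Y \ S).card ≤ 1)).card ≤
      S.card.choose k + (W.card - S.card) * S.card.choose (k - 1) := by
  set bad₁ := S.powersetCard k with hbad₁
  set bad₂ := ((W \ S) ×ˢ S.powersetCard (k - 1)).image (fun p => insert p.1 p.2) with hbad₂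
  have hcover : (W.powersetCard k).filter (fun Y => (Y \ S).card ≤ 1) ⊆ bad₁ ∪ bad₂ := by
    intro Y hY
    rw [Finset.mem_filter, Finset.mem_powersetCard] at hY
    obtain ⟨⟨hYW, hYk⟩, h1⟩ := hY
    rw [Finset.mem_union]
    rcases Nat.lt_or_ge (Y \ S).card 1 with h0 | h1'
    · left
      rw [hbad₁, Finset.mem_powersetCard]
      refine ⟨?_, hYk⟩
      have : Y \ S = ∅ := Finset.card_eq_zero.1 (by omega)
      intro e he
      by_contra heS
      have : e ∈ Y \ S := Finset.mem_sdiff.2 ⟨he, heS⟩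
      rw [‹Y \ S = ∅›] at this
      exact Finset.notMem_empty _ this
    · right
      obtain ⟨u, hu⟩ := Finset.card_eq_one.1 (by omega : (Y \ S).card = 1)
      have huY : u ∈ Y \ S := by rw [hu]; exact Finset.mem_singleton_self u
      rw [hbad₂, Finset.mem_image]
      refine ⟨(u, Y \ {u}), ?_, ?_⟩
      · rw [Finset.mem_product, Finset.mem_powersetCard]
        refine ⟨Finset.mem_sdiff.2 ⟨hYW (Finset.mem_sdiff.1 huY).1, (Finset.mem_sdiff.1 huY).2⟩, ?_, ?_⟩
        · intro e he
          rw [Finset.mem_sdiff, Finset.mem_singleton] at he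
          by_contra heS
          have : e ∈ Y \ S := Finset.mem_sdiff.2 ⟨he.1, heS⟩
          rw [hu, Finset.mem_singleton] at this
          exact he.2 this
        · simp only
          rw [Finset.card_sdiff_of_subset (Finset.singleton_subset_iff.2 (Finset.mem_sdiff.1 huY).1),
            Finset.card_singleton]
          omega
      · simp only
        ext e
        rw [Finset.mem_insert, Finset.mem_sdiff, Finset.mem_singleton]
        constructor
        · rintro (rfl | ⟨he, -⟩)
          · exact (Finset.mem_sdiff.1 huY).1
          · exact he
        · intro he
          by_cases heu : e = u
          · exact Or.inl heu
          · exact Or.inr ⟨he, heu⟩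
  have h1 : bad₁.card = S.card.choose k := by rw [hbad₁, Finset.card_powersetCard]
  have h2 : bad₂.card ≤ (W.card - S.card) * S.card.choose (k - 1) := by
    rw [hbad₂]
    refine (Finset.card_image_le).trans ?_
    rw [Finset.card_product, Finset.card_powersetCard, Finset.card_sdiff_of_subset hS]
  have h3 := Finset.card_le_card hcover
  have h4 := Finset.card_union_le bad₁ bad₂
  omega

/-- **The union bound for three conditions**: `C(|W|, k) ≤ #{Y : Q₁ Y ∧ Q₂ Y ∧ Q₃ Y} + #{¬ Q₁} + #{¬ Q₂} + #{¬ Q₃}`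
over the `k`-subsets of `W`. -/
theorem choose_le_card_filter_three (W : Finset α) (k : ℕ) (Q₁ Q₂ Q₃ : Finset α → Prop) [DecidablePred Q₁]
    [DecidablePred Q₂] [DecidablePred Q₃] :
    W.card.choose k ≤ ((W.powersetCard k).filter (fun Y => Q₁ Y ∧ Q₂ Y ∧ Q₃ Y)).card +
      ((W.powersetCard k).filter (fun Y => ¬ Q₁ Y)).card + ((W.powersetCard k).filter (fun Y => ¬ Q₂ Y)).card +
      ((W.powersetCard k).filter (fun Y => ¬ Q₃ Y)).card := by
  set P := W.powersetCard k with hP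
  have hsplit : (P.filter (fun Y => Q₁ Y ∧ Q₂ Y ∧ Q₃ Y)).card +
      (P.filter (fun Y => ¬ (Q₁ Y ∧ Q₂ Y ∧ Q₃ Y))).card = P.card :=
    Finset.card_filter_add_card_filter_not (s := P) _
  have hPc : P.card = W.card.choose k := Finset.card_powersetCard k W
  have hcover : P.filter (fun Y => ¬ (Q₁ Y ∧ Q₂ Y ∧ Q₃ Y)) ⊆
      P.filter (fun Y => ¬ Q₁ Y) ∪ (P.filter (fun Y => ¬ Q₂ Y) ∪ P.filter (fun Y => ¬ Q₃ Y)) := by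
    intro Y hY
    rw [Finset.mem_filter] at hY
    rw [Finset.mem_union, Finset.mem_union, Finset.mem_filter, Finset.mem_filter, Finset.mem_filter]
    by_cases h1 : Q₁ Y
    · by_cases h2 : Q₂ Y
      · exact Or.inr (Or.inr ⟨hY.1, fun h3 => hY.2 ⟨h1, h2, h3⟩⟩)
      · exact Or.inr (Or.inl ⟨hY.1, h2⟩)
    · exact Or.inl ⟨hY.1, h1⟩
  have h3 := Finset.card_le_card hcover
  have h4 := Finset.card_union_le (P.filter (fun Y => ¬ Q₁ Y)) (P.filter (fun Y => ¬ Q₂ Y) ∪ P.filter (fun Y => ¬ Q₃ Y))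
  have h5 := Finset.card_union_le (P.filter (fun Y => ¬ Q₂ Y)) (P.filter (fun Y => ¬ Q₃ Y))
  omega

omit [DecidableEq α] in
/-- A condition implied by another has the smaller complement: `#{¬ Q} ≤ #{¬ Q'}` when `Q' → Q`. -/
theorem card_filter_not_le_of_imp (P : Finset (Finset α)) (Q Q' : Finset α → Prop) [DecidablePred Q]
    [DecidablePred Q'] (h : ∀ Y, Q' Y → Q Y) :
    (P.filter (fun Y => ¬ Q Y)).card ≤ (P.filter (fun Y => ¬ Q' Y)).card := by
  apply Finset.card_le_card
  intro Y hY
  rw [Finset.mem_filter] at hY ⊢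
  exact ⟨hY.1, fun h' => hY.2 (h Y h')⟩

end PercRepro.Shadow
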